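import Mathlib.Analysis.SpecificLimits.Basic
import Literature.Analysis.FluidPDE.NormalisedPressurePV
import Literature.Analysis.FluidPDE.NormalisedPressureLpBoundProofs
import HarnessLib

/-!
# Forward DSS solutions: the pressure kernel bounds behind Bradshaw–Tsai 2019, Prop. 3.1

Analysis/FluidPDE tool file (definitions + proved theorems) in the decomposition of
`Literature.Analysis.FluidPDE.bradshawTsai2019_prop_3_1` (Bradshaw–Tsai, Analysis & PDE 12
(2019) = arXiv:1801.08060, Prop. 3.1). After the accepted split of `ForwardDSSMollifiedScheme.lean`
the analytic debt is the a priori estimate `bradshawTsai2019_apriori_3_12`, whose printed proof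
(pp. 9–10) bounds the pressure of the mollified approximants through the formula

> (3.8) `π_ε(x,t) = −⅓[(η_{ε√t}*v_ε)·v_ε](x,t) + lim_{δ→0}∫_{|y|>δ} Kᵢⱼ(x−y)(η_{ε√t}*v_ε)ᵢ(y,t)(v_ε)ⱼ(y,t) dy`,
> `Kᵢⱼ(x) = ∂ᵢ∂ⱼ(4π|x|)⁻¹`,

"split … into local and non-local parts … `=: π_near(x,t) + π_far(x,t)`", with "by the
Calderon-Zygmund theory, `‖π_near(·,t)‖_{L^{3/2}(B_λ)} ≤ ‖(η_{ε√t}*v_ε)(·,t)v_ε(·,t)‖_{L^{3/2}(B_{λ²})}`"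
and the pointwise far-field estimate "`|π_far(x,t)| ≤ CΣ_{k=3}^∞ ∫_{A_k} |x−y|⁻³ |(η_{ε√t}*v_ε)||v_ε| dy
≤ C(λ)Σ_k λ^{−3k}∫_{A_k} … ≤ C(λ)α̃_ε(t)`" (`A_k = {λ^{k−1} ≤ |x| < λᵏ}`). This file supplies the
kernel-side statements of these three steps, for a *bilinear* tensor `a ⊗ c` (the printed
`(η_{ε√t}*v_ε) ⊗ v_ε` is not symmetric), over the tree's pressure kernel
`pressureForm z a c = Σᵢⱼ Kᵢⱼ(z) aᵢ cⱼ = (3⟨z,a⟩⟨z,c⟩ − ⟨a,c⟩|z|²)/(4π|z|⁵)` (`NormalisedPressurePV`)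
and its proved Calderón–Zygmund bound `stein1970_normalisedPressure_Lp_bound_holds`
(`NormalisedPressureLpBoundProofs`):

* `truncatedPressureFormIntegral a c x δ = ∫_{|x−y|>δ} Σᵢⱼ Kᵢⱼ(x−y) aᵢ(y) cⱼ(y) dy` and its
  principal value `HasPressureFormPV a c x L` (integrability of the truncated integrands for small
  `δ`, convergence as `δ → 0⁺` — the convention of the tree's diagonal `HasPressurePV`, to which it
  reduces for `a = c`, `hasPressureFormPV_self_iff`);
* **polarization** (`pressureKernel_add_sub_pressureKernel_sub`: `K(a+c) − K(a−c) = 4ΣKᵢⱼaᵢcⱼ`;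
  `HasPressurePV.hasPressureFormPV_of_add_sub`): the bilinear principal value of two `C¹ ∩ L²`
  fields exists at every point and equals `pvForm p q = ¼(diagPV(p+q) − diagPV(p−q))`,
  `diagPV u = p̃[u] + |u|²/3` (`hasPressureFormPV_pvForm`, from the tree's
  `normalisedPressure_eq_of_contDiff`);
* **the near-field bound** `lintegral_enorm_pvForm_rpow_le`: for `p, q ∈ C^∞_c`,
  `∫|pvForm p q|^{3/2} ≤ 32(C^{3/2} + 1)(∫|p|³ + ∫|q|³)` given the Calderón–Zygmund constant `C`
  of `p̃` at exponent `3/2` (in print Hölder turns `‖ab‖_{3/2}` into `‖a‖₃‖b‖₃`; here Young);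
* **the far-field bound** `lintegral_far_pressureForm_le`: if the local energies of `a`, `w` grow
  at most linearly along the balls `B_{λᵏ⁺¹}` (`∫_{B_{λᵏ⁺¹}}(|a|² + |w|²) ≤ λᵏ⁺¹M` — in print from
  (3.6) and (3.10), `M ∝ α̃_ε(t)`) then for `x ∈ B_λ`,
  `∫_{|y|≥λ²}|Σ Kᵢⱼ(x−y)aᵢwⱼ| ≤ farConst(λ) M` with
  `farConst λ = (π(1−λ⁻¹)³λ³)⁻¹(1−λ⁻²)⁻¹ < ∞` (annuli `A_k`, `|Kᵢⱼ(x−y)aᵢcⱼ| ≤ |a||c|/(π|x−y|³)`,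
  `|x−y| ≥ (1−λ⁻¹)λᵏ` on `A_k`, geometric series);
* **the splitting** `HasPressureFormPV.eq_add_far`: with a cut-off `ζ = 1` on `B_{R₁}` (a smooth
  substitute for the printed `χ_{B_{λ²}}`), a bilinear principal value `L` of `(b, w)` at
  `x ∈ B_r`, `r < R₁`, equals the principal value of the cut pair `(ζb, ζw)` plus the absolutely
  convergent far integral `∫(1 − ζ²)ΣKᵢⱼ(x−y)bᵢwⱼ`, itself dominated by the tail
  `∫_{|y|≥R₁}|ΣKᵢⱼ(x−y)bᵢwⱼ|` when `|ζ| ≤ 1` (`enorm_integral_far_le`).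

Together: for a pressure given by (3.8) at `(t, x)`, `x ∈ B_λ`,
`|π_ε − (−⅓ b·w)| ≤ |pvForm(ζb(t), ζw(t))(x)| + farConst(λ)·M(t)`, with the `L^{3/2}` control of
the first term by `∫_{B_{λ³}}(|b|³ + |w|³)`-type quantities — the two displayed pressure bounds of
p. 10, ready for the consumer of `bradshawTsai2019_apriori_3_12`.

## Mathlib / tree search

Reused, nothing redefined: `pressureKernel`, `truncatedPressureIntegral`, `HasPressurePV`,
`normalisedPressure` (`NormalisedPressure`); `pressureForm`, `abs_pressureForm_le`,
`pressureKernel_eq_pressureForm`, `normalisedPressure_eq_of_contDiff` (`NormalisedPressurePV`);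
`aestronglyMeasurable_normalisedPressure` (`NormalisedPressureL2Bound`);
`stein1970_normalisedPressure_Lp_bound(_holds)` (`NormalisedPressureLpBound(Proofs)`) — the
near-field theorem takes the bound as a hypothesis `hC` so that any constant serves. Mathlib:
`ENNReal.rpow_add_le_mul_rpow_add_rpow`, `lintegral_iUnion_le`, `ENNReal.tsum_geometric`,
`exists_nat_pow_near`, `setIntegral_eq_integral_of_forall_compl_eq_zero`, `tendsto_nhds_unique`.
`lean search 'pressureForm|HasPressureFormPV|bilinear.*PV'`: no prior bilinear principal value in
the tree (the sibling `ForwardDSSMollifiedScheme.lean` records the `L²` classes of `G` and `π_ε`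
instead of (3.8); this file is the kernel toolkit for deriving and using (3.8)).

## References

* Z. Bradshaw, T.-P. Tsai, *Discretely self-similar solutions to the Navier–Stokes equations with
  data in `L²_loc` satisfying the local energy inequality*, Analysis & PDE 12 (2019) 1943–1962 =
  arXiv:1801.08060, §3, proof of Prop. 3.1: (3.8) and the bounds for `π_near`, `π_far` (p. 10)
  [BradshawTsai2019].
* E. M. Stein, *Singular integrals and differentiability properties of functions* (1970), Ch. II
  §4.2 Thm 3 (the `L^p` bound, tree file `NormalisedPressureLpBound`) [Stein1971].
* T. Tao, Anal. PDE 6 (2013) = arXiv:1108.1165, (35) (the kernel `Kᵢⱼ` and `p̃`, tree file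
  `NormalisedPressure`) [Tao2011].
-/

noncomputable section

open MeasureTheory Set Function Filter Topology TopologicalSpace Metric
open scoped NNReal ENNReal RealInnerProductSpace ContDiff

namespace Literature.Analysis.FluidPDE

/-- Local notation for physical space `ℝ³ = EuclideanSpace ℝ (Fin 3)`. -/
local notation "ℝ³" => EuclideanSpace ℝ (Fin 3)

namespace BradshawTsai2019

/-! ## The bilinear truncated singular integrals and their principal values -/

/-- The **truncated bilinear singular integral** `∫_{|x-y|>δ} Kᵢⱼ(x-y) aᵢ(y) cⱼ(y) dy` of the
pressure kernel `Kᵢⱼ = ∂ᵢ∂ⱼ(4π|x|)⁻¹` contracted with the tensor `a ⊗ c`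
(`pressureForm z a c = (3⟨z,a⟩⟨z,c⟩ − ⟨a,c⟩|z|²)/(4π|z|⁵) = Σᵢⱼ Kᵢⱼ(z) aᵢ cⱼ`; the diagonal case
`a = c` is the tree's `truncatedPressureIntegral`). Bochner integral over the complement of the
closed `δ`-ball, junk `0` if not integrable. [cite: BradshawTsai2019, §3 (3.3) and the pressure formula of the proof of Prop 3.1] -/
def truncatedPressureFormIntegral (a c : ℝ³ → ℝ³) (x : ℝ³) (δ : ℝ) : ℝ :=
  ∫ y in (closedBall x δ)ᶜ, pressureForm (x - y) (a y) (c y)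

/-- **Bilinear principal value.** `HasPressureFormPV a c x L`: for all sufficiently small `δ > 0`
the truncated integrand `y ↦ Σᵢⱼ Kᵢⱼ(x-y) aᵢ(y) cⱼ(y)` is integrable on `{|x-y| > δ}`, and the
truncated integrals converge to `L` as `δ → 0⁺`:
`L = lim_{δ→0} ∫_{|x-y|>δ} Kᵢⱼ(x-y) aᵢ(y) cⱼ(y) dy` (Bradshaw–Tsai 2019, (3.3) and the pressure
formula in the proof of Prop. 3.1, with `a = η_{ε√t} * v_ε`, `c = v_ε`). The diagonal case is the
tree's `HasPressurePV` (`hasPressureFormPV_self_iff`). [cite: BradshawTsai2019, §3 (3.3)] -/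
def HasPressureFormPV (a c : ℝ³ → ℝ³) (x : ℝ³) (L : ℝ) : Prop :=
  (∀ᶠ δ in 𝓝[>] (0 : ℝ),
      IntegrableOn (fun y => pressureForm (x - y) (a y) (c y)) (closedBall x δ)ᶜ) ∧
    Tendsto (truncatedPressureFormIntegral a c x) (𝓝[>] 0) (𝓝 L)

/-- On the diagonal the truncated bilinear integral is the tree's truncated pressure integral.
[folklore] -/
theorem truncatedPressureFormIntegral_self (u : ℝ³ → ℝ³) (x : ℝ³) :
    truncatedPressureFormIntegral u u x = truncatedPressureIntegral u x := by
  funext δ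
  simp [truncatedPressureFormIntegral, truncatedPressureIntegral, pressureKernel_eq_pressureForm]

/-- On the diagonal the bilinear principal value is the tree's `HasPressurePV`. [folklore] -/
theorem hasPressureFormPV_self_iff (u : ℝ³ → ℝ³) (x : ℝ³) (L : ℝ) :
    HasPressureFormPV u u x L ↔ HasPressurePV u x L := by
  simp only [HasPressureFormPV, HasPressurePV, truncatedPressureFormIntegral_self,
    pressureKernel_eq_pressureForm]

/-- The bilinear principal value is unique. [folklore] -/
theorem HasPressureFormPV.unique {a c : ℝ³ → ℝ³} {x : ℝ³} {L₁ L₂ : ℝ}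
    (h₁ : HasPressureFormPV a c x L₁) (h₂ : HasPressureFormPV a c x L₂) : L₁ = L₂ :=
  tendsto_nhds_unique h₁.2 h₂.2

/-- The zero tensor has bilinear principal value `0`. [folklore] -/
theorem hasPressureFormPV_zero_left (c : ℝ³ → ℝ³) (x : ℝ³) :
    HasPressureFormPV 0 c x 0 := by
  refine ⟨Eventually.of_forall fun δ => ?_, ?_⟩
  · simp [pressureForm]
  · have : truncatedPressureFormIntegral 0 c x = fun _ => 0 := by
      funext δ; simp [truncatedPressureFormIntegral, pressureForm]
    rw [this]
    exact tendsto_const_nhds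


/-! ## Polarization: the bilinear principal value from the diagonal one -/

/-- **Polarization of the pressure form:** `K(z)(a + c) − K(z)(a − c) = 4 Σᵢⱼ Kᵢⱼ(z) aᵢ cⱼ`
(`B_z` is symmetric bilinear with `K(z)(v) = B_z(v, v)`). [folklore] -/
theorem pressureKernel_add_sub_pressureKernel_sub (z a c : ℝ³) :
    pressureKernel z (a + c) - pressureKernel z (a - c) = 4 * pressureForm z a c := by
  rw [pressureKernel_eq_pressureForm, pressureKernel_eq_pressureForm]
  simp only [pressureForm, inner_add_left, inner_add_right, inner_sub_left, inner_sub_right,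
    real_inner_comm c a]
  rw [div_sub_div_same, mul_div_assoc']
  congr 1
  ring

/-- The truncated bilinear integral is the polarization of the diagonal ones, as soon as these
are (absolutely) convergent. [folklore] -/
theorem truncatedPressureFormIntegral_eq_of_integrable {p q : ℝ³ → ℝ³} {x : ℝ³} {δ : ℝ}
    (h₁ : IntegrableOn (fun y => pressureKernel (x - y) ((p + q) y)) (closedBall x δ)ᶜ)
    (h₂ : IntegrableOn (fun y => pressureKernel (x - y) ((p - q) y)) (closedBall x δ)ᶜ) :
    truncatedPressureFormIntegral p q x δ =
      4⁻¹ * (truncatedPressureIntegral (p + q) x δ - truncatedPressureIntegral (p - q) x δ) := by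
  rw [truncatedPressureFormIntegral, truncatedPressureIntegral, truncatedPressureIntegral,
    ← integral_sub h₁ h₂, ← integral_const_mul]
  refine integral_congr_ae (ae_of_all _ fun y => ?_)
  simp only [Pi.add_apply, Pi.sub_apply]
  rw [pressureKernel_add_sub_pressureKernel_sub]
  ring

/-- **The bilinear principal value by polarization**: if `p + q` and `p − q` have principal
values `L₊`, `L₋` at `x`, then `(p, q)` has the bilinear principal value `(L₊ − L₋)/4`.
[folklore] -/
theorem HasPressurePV.hasPressureFormPV_of_add_sub {p q : ℝ³ → ℝ³} {x : ℝ³} {L₁ L₂ : ℝ}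
    (h₁ : HasPressurePV (p + q) x L₁) (h₂ : HasPressurePV (p - q) x L₂) :
    HasPressureFormPV p q x (4⁻¹ * (L₁ - L₂)) := by
  have hint : ∀ᶠ δ in 𝓝[>] (0 : ℝ),
      IntegrableOn (fun y => pressureKernel (x - y) ((p + q) y)) (closedBall x δ)ᶜ ∧
        IntegrableOn (fun y => pressureKernel (x - y) ((p - q) y)) (closedBall x δ)ᶜ :=
    h₁.1.and h₂.1
  refine ⟨?_, ?_⟩
  · filter_upwards [hint] with δ hδ
    have : (fun y => pressureForm (x - y) (p y) (q y)) = fun y =>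
        4⁻¹ * (pressureKernel (x - y) ((p + q) y) - pressureKernel (x - y) ((p - q) y)) := by
      funext y
      simp only [Pi.add_apply, Pi.sub_apply]
      rw [pressureKernel_add_sub_pressureKernel_sub]
      ring
    rw [this]
    exact (hδ.1.sub hδ.2).const_mul _
  · have hev : (fun δ => 4⁻¹ * (truncatedPressureIntegral (p + q) x δ -
        truncatedPressureIntegral (p - q) x δ)) =ᶠ[𝓝[>] 0] truncatedPressureFormIntegral p q x := by
      filter_upwards [hint] with δ hδ
      exact (truncatedPressureFormIntegral_eq_of_integrable hδ.1 hδ.2).symm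
    exact ((h₁.2.sub h₂.2).const_mul 4⁻¹).congr' hev

/-! ## The near-field part: polarization and the Calderón–Zygmund bound -/

/-- The principal value `p.v.∫ K(x−y)(u(y)) dy = p̃[u](x) + |u(x)|²/3` of the diagonal singular
integral of a field `u` (meaningful on the admissible locus of `normalisedPressure`, e.g.
`u ∈ C¹ ∩ L²`). [folklore] -/
def diagPV (u : ℝ³ → ℝ³) (x : ℝ³) : ℝ :=
  normalisedPressure u x + ‖u x‖ ^ 2 / 3

/-- For `u ∈ C¹(ℝ³; ℝ³) ∩ L²`, `diagPV u x` **is** the principal value at every point (the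
tree's `normalisedPressure_eq_of_contDiff`). [folklore] -/
theorem hasPressurePV_diagPV {u : ℝ³ → ℝ³} (hu : ContDiff ℝ 1 u) (hE : (∫⁻ x, ‖u x‖ₑ ^ 2) < ⊤)
    (x : ℝ³) : HasPressurePV u x (diagPV u x) := by
  obtain ⟨L, hL, heq⟩ := normalisedPressure_eq_of_contDiff hu hE x
  have : diagPV u x = L := by rw [diagPV, heq]; ring
  rwa [this]

/-- The **bilinear principal value of two `C¹ ∩ L²` fields**, by polarization:
`pvForm p q = ¼(diagPV(p + q) − diagPV(p − q))`. [folklore] -/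
def pvForm (p q : ℝ³ → ℝ³) (x : ℝ³) : ℝ :=
  4⁻¹ * (diagPV (p + q) x - diagPV (p - q) x)

/-- `C¹` fields with finite energy have finite energy sums and differences. [folklore] -/
theorem lintegral_enorm_sq_add_lt_top {p q : ℝ³ → ℝ³} (hp : Continuous p) (hq : Continuous q)
    (hpE : (∫⁻ x, ‖p x‖ₑ ^ 2) < ⊤) (hqE : (∫⁻ x, ‖q x‖ₑ ^ 2) < ⊤) :
    (∫⁻ x, ‖(p + q) x‖ₑ ^ 2) < ⊤ := by
  have h2 : MemLp p 2 volume := by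
    refine ⟨hp.aestronglyMeasurable, ?_⟩
    rw [eLpNorm_lt_top_iff_lintegral_rpow_enorm_lt_top two_ne_zero ENNReal.ofNat_ne_top]
    simpa using hpE
  have h2' : MemLp q 2 volume := by
    refine ⟨hq.aestronglyMeasurable, ?_⟩
    rw [eLpNorm_lt_top_iff_lintegral_rpow_enorm_lt_top two_ne_zero ENNReal.ofNat_ne_top]
    simpa using hqE
  have := (h2.add h2').2
  rw [eLpNorm_lt_top_iff_lintegral_rpow_enorm_lt_top two_ne_zero ENNReal.ofNat_ne_top] at this
  simpa using this

/-- For `p, q ∈ C¹(ℝ³; ℝ³) ∩ L²`, `pvForm p q x` is the bilinear principal value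
`lim_{δ→0}∫_{|x−y|>δ} Σᵢⱼ Kᵢⱼ(x−y) pᵢ(y) qⱼ(y) dy` at every point. [folklore] -/
theorem hasPressureFormPV_pvForm {p q : ℝ³ → ℝ³} (hp : ContDiff ℝ 1 p) (hq : ContDiff ℝ 1 q)
    (hpE : (∫⁻ x, ‖p x‖ₑ ^ 2) < ⊤) (hqE : (∫⁻ x, ‖q x‖ₑ ^ 2) < ⊤) (x : ℝ³) :
    HasPressureFormPV p q x (pvForm p q x) := by
  have hs := lintegral_enorm_sq_add_lt_top hp.continuous hq.continuous hpE hqE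
  have hd : (∫⁻ x, ‖(p - q) x‖ₑ ^ 2) < ⊤ := by
    have := lintegral_enorm_sq_add_lt_top hp.continuous hq.continuous.neg hpE (by simpa using hqE)
    simpa [sub_eq_add_neg] using this
  have h₁ : HasPressurePV (p + q) x (diagPV (p + q) x) := hasPressurePV_diagPV (hp.add hq) hs x
  have h₂ : HasPressurePV (p - q) x (diagPV (p - q) x) := hasPressurePV_diagPV (hp.sub hq) hd x
  exact HasPressurePV.hasPressureFormPV_of_add_sub h₁ h₂

/-- `∫ |p̃[u]|^{3/2} ≤ C^{3/2} ∫ |u|³` for `u ∈ C^∞_c`: the tree's Calderón–Zygmund bound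
`stein1970_normalisedPressure_Lp_bound_holds` with `p = 3/2`, in `lintegral` form. [folklore] -/
theorem lintegral_enorm_normalisedPressure_rpow_le {C : ℝ≥0}
    (hC : ∀ w : ℝ³ → ℝ³, ContDiff ℝ ∞ w → HasCompactSupport w →
      eLpNorm (normalisedPressure w) (3 / 2 : ℝ≥0∞) volume ≤
        C * eLpNorm (fun x => ‖w x‖ ^ 2) (3 / 2 : ℝ≥0∞) volume)
    {u : ℝ³ → ℝ³} (hu : ContDiff ℝ ∞ u) (huc : HasCompactSupport u) :
    ∫⁻ x, ‖normalisedPressure u x‖ₑ ^ (3 / 2 : ℝ) ≤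
      (C : ℝ≥0∞) ^ (3 / 2 : ℝ) * ∫⁻ x, ‖u x‖ₑ ^ (3 : ℝ) := by
  have h32 : (3 / 2 : ℝ≥0∞) ≠ 0 := by norm_num
  have h32' : (3 / 2 : ℝ≥0∞) ≠ ⊤ := ENNReal.div_ne_top (by norm_num) (by norm_num)
  have htr : (3 / 2 : ℝ≥0∞).toReal = 3 / 2 := by
    rw [ENNReal.toReal_div]; norm_num
  have key := hC u hu huc
  rw [eLpNorm_eq_lintegral_rpow_enorm_toReal h32 h32',
    eLpNorm_eq_lintegral_rpow_enorm_toReal h32 h32', htr] at key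
  have hpos : (0 : ℝ) < 3 / 2 := by norm_num
  have key' := ENNReal.rpow_le_rpow key hpos.le
  rw [← ENNReal.rpow_mul, one_div_mul_cancel hpos.ne', ENNReal.rpow_one,
    ENNReal.mul_rpow_of_nonneg _ _ hpos.le, ← ENNReal.rpow_mul, one_div_mul_cancel hpos.ne',
    ENNReal.rpow_one] at key'
  refine key'.trans (le_of_eq ?_)
  congr 1
  refine lintegral_congr fun x => ?_
  rw [Real.enorm_eq_ofReal (sq_nonneg _), ENNReal.ofReal_pow (norm_nonneg _), ofReal_norm,
    ← ENNReal.rpow_natCast, ← ENNReal.rpow_mul]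
  norm_num

/-- `(a + b + c + d)^{3/2} ≤ 4(a^{3/2} + b^{3/2} + c^{3/2} + d^{3/2})` in `ℝ≥0∞`. [folklore] -/
theorem rpow_three_halves_add_four_le (a b c d : ℝ≥0∞) :
    (a + b + c + d) ^ (3 / 2 : ℝ) ≤
      4 * (a ^ (3 / 2 : ℝ) + b ^ (3 / 2 : ℝ) + c ^ (3 / 2 : ℝ) + d ^ (3 / 2 : ℝ)) := by
  have h32 : (1 : ℝ) ≤ 3 / 2 := by norm_num
  have hs : (2 : ℝ≥0∞) ^ ((3 / 2 : ℝ) - 1) ≤ 2 := by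
    conv_rhs => rw [← ENNReal.rpow_one 2]
    exact ENNReal.rpow_le_rpow_of_exponent_le (by norm_num) (by norm_num)
  have step : ∀ u v : ℝ≥0∞, (u + v) ^ (3 / 2 : ℝ) ≤ 2 * (u ^ (3 / 2 : ℝ) + v ^ (3 / 2 : ℝ)) :=
    fun u v => (ENNReal.rpow_add_le_mul_rpow_add_rpow u v h32).trans (mul_le_mul' hs le_rfl)
  calc (a + b + c + d) ^ (3 / 2 : ℝ) = ((a + b) + (c + d)) ^ (3 / 2 : ℝ) := by rw [add_assoc]
    _ ≤ 2 * ((a + b) ^ (3 / 2 : ℝ) + (c + d) ^ (3 / 2 : ℝ)) := step _ _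
    _ ≤ 2 * (2 * (a ^ (3 / 2 : ℝ) + b ^ (3 / 2 : ℝ)) + 2 * (c ^ (3 / 2 : ℝ) + d ^ (3 / 2 : ℝ))) := by
        gcongr <;> exact step _ _
    _ = 4 * (a ^ (3 / 2 : ℝ) + b ^ (3 / 2 : ℝ) + c ^ (3 / 2 : ℝ) + d ^ (3 / 2 : ℝ)) := by ring




/-- `(u + v)³ ≤ 4(u³ + v³)` in `ℝ≥0∞`, real exponent. [folklore] -/
theorem rpow_three_add_le (u v : ℝ≥0∞) :
    (u + v) ^ (3 : ℝ) ≤ 4 * (u ^ (3 : ℝ) + v ^ (3 : ℝ)) := by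
  have h := ENNReal.rpow_add_le_mul_rpow_add_rpow u v (by norm_num : (1 : ℝ) ≤ 3)
  have h4 : (2 : ℝ≥0∞) ^ ((3 : ℝ) - 1) = 4 := by
    rw [show (3 : ℝ) - 1 = (2 : ℕ) by norm_num, ENNReal.rpow_natCast]; norm_num
  rwa [h4] at h

/-- `∫ |u ± v|³ ≤ 4(∫|u|³ + ∫|v|³)` for continuous fields. [folklore] -/
theorem lintegral_enorm_add_rpow_three_le {p q : ℝ³ → ℝ³} (hp : Continuous p) :
    ∫⁻ x, ‖p x + q x‖ₑ ^ (3 : ℝ) ≤ 4 * ((∫⁻ x, ‖p x‖ₑ ^ (3 : ℝ)) + ∫⁻ x, ‖q x‖ₑ ^ (3 : ℝ)) := by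
  calc ∫⁻ x, ‖p x + q x‖ₑ ^ (3 : ℝ) ≤ ∫⁻ x, 4 * (‖p x‖ₑ ^ (3 : ℝ) + ‖q x‖ₑ ^ (3 : ℝ)) :=
        lintegral_mono fun x => (ENNReal.rpow_le_rpow (enorm_add_le _ _) (by norm_num)).trans
          (rpow_three_add_le _ _)
    _ = 4 * ((∫⁻ x, ‖p x‖ₑ ^ (3 : ℝ)) + ∫⁻ x, ‖q x‖ₑ ^ (3 : ℝ)) := by
        rw [lintegral_const_mul' _ _ (by norm_num),
          lintegral_add_left (hp.enorm.measurable.pow_const _)]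

/-- Pointwise: `|pvForm p q| ≤ |p̃[p+q]| + |p+q|² + |p̃[p−q]| + |p−q|²`. [folklore] -/
theorem enorm_pvForm_le (p q : ℝ³ → ℝ³) (x : ℝ³) :
    ‖pvForm p q x‖ₑ ≤ ‖normalisedPressure (p + q) x‖ₑ + ‖(p + q) x‖ₑ ^ 2 +
      ‖normalisedPressure (p - q) x‖ₑ + ‖(p - q) x‖ₑ ^ 2 := by
  have hdiag : ∀ u : ℝ³ → ℝ³, ‖diagPV u x‖ₑ ≤ ‖normalisedPressure u x‖ₑ + ‖u x‖ₑ ^ 2 := by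
    intro u
    rw [diagPV]
    refine (enorm_add_le _ _).trans (add_le_add le_rfl ?_)
    rw [Real.enorm_eq_ofReal (by positivity), ← ofReal_norm, ← ENNReal.ofReal_pow (norm_nonneg _)]
    exact ENNReal.ofReal_le_ofReal (div_le_self (sq_nonneg _) (by norm_num))
  rw [pvForm, enorm_mul]
  have h4 : ‖(4⁻¹ : ℝ)‖ₑ ≤ 1 := by
    rw [Real.enorm_eq_ofReal (by norm_num), ← ENNReal.ofReal_one]
    exact ENNReal.ofReal_le_ofReal (by norm_num)
  calc ‖(4⁻¹ : ℝ)‖ₑ * ‖diagPV (p + q) x - diagPV (p - q) x‖ₑ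
      ≤ 1 * (‖diagPV (p + q) x‖ₑ + ‖diagPV (p - q) x‖ₑ) := mul_le_mul' h4 (enorm_sub_le)
    _ ≤ ‖normalisedPressure (p + q) x‖ₑ + ‖(p + q) x‖ₑ ^ 2 +
          (‖normalisedPressure (p - q) x‖ₑ + ‖(p - q) x‖ₑ ^ 2) := by
        rw [one_mul]; exact add_le_add (hdiag _) (hdiag _)
    _ = _ := by rw [← add_assoc]

/-- The constant of the near-field bound in terms of a Calderón–Zygmund constant `C` at
`p = 3/2`: `32 (C^{3/2} + 1)`. [folklore] -/
def nearConst (C : ℝ≥0) : ℝ≥0∞ := 32 * ((C : ℝ≥0∞) ^ (3 / 2 : ℝ) + 1)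

/-- The near-field constant is finite. [folklore] -/
theorem nearConst_lt_top (C : ℝ≥0) : nearConst C < ⊤ :=
  ENNReal.mul_lt_top (by norm_num) (ENNReal.add_lt_top.2
    ⟨ENNReal.rpow_lt_top_of_nonneg (by norm_num) ENNReal.coe_ne_top, ENNReal.one_lt_top⟩)

/-- **The near-field bound** (Bradshaw–Tsai 2019, p. 10: "To bound `π_near` note that, by the
Calderon-Zygmund theory, `‖π_near(·,t)‖_{L^{3/2}(B_λ)} ≤ ‖(η_{ε√t}*v_ε)(·,t) v_ε(·,t)‖_{L^{3/2}(B_{λ²})}`"),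
in the polarized form over the tree's Calderón–Zygmund bound for the normalised pressure: given
the `L^{3/2}` bound `‖p̃[w]‖_{3/2} ≤ C‖|w|²‖_{3/2}` on `C^∞_c` (proved in the tree,
`stein1970_normalisedPressure_Lp_bound_holds`), for `p, q ∈ C^∞_c(ℝ³; ℝ³)` the bilinear
principal value `pvForm p q = p.v.∫ Σᵢⱼ Kᵢⱼ(·−y) pᵢ(y) qⱼ(y) dy` obeys
`∫ |pvForm p q|^{3/2} ≤ 32(C^{3/2} + 1)(∫|p|³ + ∫|q|³)` (polarization
`4 pvForm = diagPV(p+q) − diagPV(p−q)`, `diagPV u = p̃[u] + |u|²/3`, Young).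
[cite: BradshawTsai2019, §3 proof of Prop 3.1 (bound for π_near, p. 10)] -/
theorem lintegral_enorm_pvForm_rpow_le {C : ℝ≥0}
    (hC : ∀ w : ℝ³ → ℝ³, ContDiff ℝ ∞ w → HasCompactSupport w →
      eLpNorm (normalisedPressure w) (3 / 2 : ℝ≥0∞) volume ≤
        C * eLpNorm (fun x => ‖w x‖ ^ 2) (3 / 2 : ℝ≥0∞) volume)
    {p q : ℝ³ → ℝ³} (hp : ContDiff ℝ ∞ p) (hpc : HasCompactSupport p) (hq : ContDiff ℝ ∞ q)
    (hqc : HasCompactSupport q) :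
    ∫⁻ x, ‖pvForm p q x‖ₑ ^ (3 / 2 : ℝ) ≤
      nearConst C * ((∫⁻ x, ‖p x‖ₑ ^ (3 : ℝ)) + ∫⁻ x, ‖q x‖ₑ ^ (3 : ℝ)) := by
  set P : ℝ≥0∞ := ∫⁻ x, ‖p x‖ₑ ^ (3 : ℝ) with hP
  set Q : ℝ≥0∞ := ∫⁻ x, ‖q x‖ₑ ^ (3 : ℝ) with hQ
  set K : ℝ≥0∞ := (C : ℝ≥0∞) ^ (3 / 2 : ℝ) with hK
  have hs : ContDiff ℝ ∞ (p + q) := hp.add hq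
  have hsc : HasCompactSupport (p + q) := hpc.add hqc
  have hd : ContDiff ℝ ∞ (p - q) := hp.sub hq
  have hdc : HasCompactSupport (p - q) := hpc.sub hqc
  -- the four integrals
  have hsq : ∀ u : ℝ³ → ℝ³, ∀ x, (‖u x‖ₑ ^ 2) ^ (3 / 2 : ℝ) = ‖u x‖ₑ ^ (3 : ℝ) := fun u x => by
    rw [← ENNReal.rpow_natCast, ← ENNReal.rpow_mul]; norm_num
  have I1 : ∫⁻ x, ‖normalisedPressure (p + q) x‖ₑ ^ (3 / 2 : ℝ) ≤ K * (4 * (P + Q)) :=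
    (lintegral_enorm_normalisedPressure_rpow_le hC hs hsc).trans
      (mul_le_mul' le_rfl (lintegral_enorm_add_rpow_three_le hp.continuous))
  have I2 : ∫⁻ x, (‖(p + q) x‖ₑ ^ 2) ^ (3 / 2 : ℝ) ≤ 4 * (P + Q) := by
    simp_rw [hsq]
    exact lintegral_enorm_add_rpow_three_le hp.continuous
  have I3 : ∫⁻ x, ‖normalisedPressure (p - q) x‖ₑ ^ (3 / 2 : ℝ) ≤ K * (4 * (P + Q)) := by
    refine (lintegral_enorm_normalisedPressure_rpow_le hC hd hdc).trans (mul_le_mul' le_rfl ?_)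
    have := lintegral_enorm_add_rpow_three_le (q := fun x => -q x) hp.continuous
    simpa only [enorm_neg, Pi.sub_apply, sub_eq_add_neg] using this
  have I4 : ∫⁻ x, (‖(p - q) x‖ₑ ^ 2) ^ (3 / 2 : ℝ) ≤ 4 * (P + Q) := by
    simp_rw [hsq]
    have := lintegral_enorm_add_rpow_three_le (q := fun x => -q x) hp.continuous
    simpa only [enorm_neg, Pi.sub_apply, sub_eq_add_neg] using this
  -- measurability of the summands
  have m1 : AEMeasurable (fun x => ‖normalisedPressure (p + q) x‖ₑ ^ (3 / 2 : ℝ)) volume :=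
    (aestronglyMeasurable_normalisedPressure hs hsc).enorm.pow_const _
  have m2 : AEMeasurable (fun x => (‖(p + q) x‖ₑ ^ 2) ^ (3 / 2 : ℝ)) volume :=
    ((hs.continuous.enorm.measurable.pow_const _).pow_const _).aemeasurable
  have m3 : AEMeasurable (fun x => ‖normalisedPressure (p - q) x‖ₑ ^ (3 / 2 : ℝ)) volume :=
    (aestronglyMeasurable_normalisedPressure hd hdc).enorm.pow_const _
  calc ∫⁻ x, ‖pvForm p q x‖ₑ ^ (3 / 2 : ℝ)
      ≤ ∫⁻ x, 4 * (‖normalisedPressure (p + q) x‖ₑ ^ (3 / 2 : ℝ) +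
          (‖(p + q) x‖ₑ ^ 2) ^ (3 / 2 : ℝ) + ‖normalisedPressure (p - q) x‖ₑ ^ (3 / 2 : ℝ) +
          (‖(p - q) x‖ₑ ^ 2) ^ (3 / 2 : ℝ)) :=
        lintegral_mono fun x => (ENNReal.rpow_le_rpow (enorm_pvForm_le p q x) (by norm_num)).trans
          (rpow_three_halves_add_four_le _ _ _ _)
    _ = 4 * ((∫⁻ x, ‖normalisedPressure (p + q) x‖ₑ ^ (3 / 2 : ℝ)) +
          (∫⁻ x, (‖(p + q) x‖ₑ ^ 2) ^ (3 / 2 : ℝ)) +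
          (∫⁻ x, ‖normalisedPressure (p - q) x‖ₑ ^ (3 / 2 : ℝ)) +
          ∫⁻ x, (‖(p - q) x‖ₑ ^ 2) ^ (3 / 2 : ℝ)) := by
        have m12 : AEMeasurable (fun x => ‖normalisedPressure (p + q) x‖ₑ ^ (3 / 2 : ℝ) +
            (‖(p + q) x‖ₑ ^ 2) ^ (3 / 2 : ℝ)) volume := m1.add m2
        have m123 : AEMeasurable (fun x => ‖normalisedPressure (p + q) x‖ₑ ^ (3 / 2 : ℝ) +
            (‖(p + q) x‖ₑ ^ 2) ^ (3 / 2 : ℝ) + ‖normalisedPressure (p - q) x‖ₑ ^ (3 / 2 : ℝ)) volume :=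
          m12.add m3
        rw [lintegral_const_mul' _ _ (by norm_num), lintegral_add_left' m123,
          lintegral_add_left' m12, lintegral_add_left' m1]
    _ ≤ 4 * (K * (4 * (P + Q)) + 4 * (P + Q) + K * (4 * (P + Q)) + 4 * (P + Q)) := by
        gcongr
    _ = nearConst C * (P + Q) := by
        rw [nearConst, ← hK]
        ring

/-! ## The far-field part of the pressure: annuli and the kernel decay -/

section FarField

/-- `|Σ Kᵢⱼ(z)aᵢcⱼ| ≤ |a||c|/(π|z|³)` in `ℝ≥0∞` form (the tree's `abs_pressureForm_le`). [folklore] -/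
theorem enorm_pressureForm_le (z a c : ℝ³) :
    ‖pressureForm z a c‖ₑ ≤ ENNReal.ofReal (Real.pi * ‖z‖ ^ 3)⁻¹ * (‖a‖ₑ * ‖c‖ₑ) := by
  rw [Real.enorm_eq_ofReal_abs, ← ofReal_norm, ← ofReal_norm,
    ← ENNReal.ofReal_mul (norm_nonneg _), ← ENNReal.ofReal_mul (inv_nonneg.2 (by positivity))]
  refine ENNReal.ofReal_le_ofReal ?_
  rw [inv_mul_eq_div]
  exact abs_pressureForm_le z a c

/-- On the annulus `A_k = {λᵏ ≤ |y| < λᵏ⁺¹}`, `k ≥ 2`, a point `x ∈ B_λ` is at distance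
`≥ (1 − λ⁻¹)λᵏ` from `y` (Bradshaw–Tsai 2019, p. 10: "`|π_far(x,t)| ≤ CΣ_{k=3}^∞ ∫_{A_k} |x−y|⁻³ …
≤ C(λ)Σ λ^{−3k}∫_{A_k} …` whenever `x ∈ B_λ`"). [cite: BradshawTsai2019, §3 proof of Prop 3.1 (bound for π_far, p. 10)] -/
theorem sub_norm_ge_of_mem_annulus {c : ℝ} (hc : 1 < c) {x y : ℝ³} (hx : ‖x‖ < c) {k : ℕ}
    (hk : 2 ≤ k) (hy : c ^ k ≤ ‖y‖) : (1 - c⁻¹) * c ^ k ≤ ‖x - y‖ := by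
  have hc0 : 0 < c := one_pos.trans hc
  have h1 : c ≤ c⁻¹ * c ^ k := by
    obtain ⟨m, rfl⟩ := Nat.exists_eq_add_of_le hk
    rw [pow_add, ← mul_assoc, sq, ← mul_assoc, inv_mul_cancel₀ hc0.ne', one_mul]
    exact le_mul_of_one_le_right hc0.le (one_le_pow₀ hc.le)
  calc (1 - c⁻¹) * c ^ k = c ^ k - c⁻¹ * c ^ k := by ring
    _ ≤ ‖y‖ - ‖x‖ := sub_le_sub hy (hx.le.trans h1)
    _ ≤ ‖x - y‖ := by
        rw [← norm_neg (x - y), neg_sub]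
        exact norm_sub_norm_le y x |>.trans (le_of_eq (by rw [norm_sub_rev]))

/-- The constant of the far-field bound, `(π(1−λ⁻¹)³λ³)⁻¹ (1 − λ⁻²)⁻¹` (finite for `λ > 1`). [folklore] -/
def farConst (c : ℝ) : ℝ≥0∞ :=
  ENNReal.ofReal (Real.pi * (1 - c⁻¹) ^ 3 * c ^ 3)⁻¹ * (1 - ENNReal.ofReal (c⁻¹ ^ 2))⁻¹

/-- The far-field constant is finite. [folklore] -/
theorem farConst_lt_top {c : ℝ} (hc : 1 < c) : farConst c < ⊤ := by
  refine ENNReal.mul_lt_top ENNReal.ofReal_lt_top (ENNReal.inv_lt_top.2 ?_)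
  rw [tsub_pos_iff_lt, ← ENNReal.ofReal_one]
  refine (ENNReal.ofReal_lt_ofReal_iff one_pos).2 ?_
  have : c⁻¹ < 1 := inv_lt_one_of_one_lt₀ hc
  have h0 : 0 < c⁻¹ := inv_pos.2 (one_pos.trans hc)
  nlinarith

/-- **The far-field bound** (Bradshaw–Tsai 2019, p. 10, the pointwise estimate of `π_far`): for
`λ > 1`, fields `a`, `w` whose local energies grow at most linearly along the balls `B_{λᵏ⁺¹}`,
`∫_{B_{λᵏ⁺¹}}(|a|² + |w|²) ≤ λᵏ⁺¹M`, and `x ∈ B_λ`: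
`∫_{|y|≥λ²} |Σᵢⱼ Kᵢⱼ(x−y)aᵢ(y)wⱼ(y)| dy ≤ C(λ) M` (split `{|y| ≥ λ²} ⊆ ⋃_{k≥2} A_k`, on `A_k`
`|Kᵢⱼ(x−y)| ≤ (π(1−λ⁻¹)³λ³ᵏ)⁻¹`, `|a||w| ≤ |a|² + |w|²`, and sum the geometric series
`Σ_k λ⁻³ᵏλᵏ⁺¹`). In print `a = η_{ε√t}*v_ε`, `w = v_ε`, `M ∝ α̃_ε(t)` by (3.6) and (3.8):
"`|π_far(x,t)| ≤ … ≤ C(λ)Σ_{k} λ^{−2k}‖v_ε(tλ^{−2k})‖²_{L²(B_{λ²})} ≤ C(λ)α̃_ε(t)`".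
[cite: BradshawTsai2019, §3 proof of Prop 3.1 (bound for π_far, p. 10)] -/
theorem lintegral_far_pressureForm_le {c : ℝ} (hc : 1 < c) {a w : ℝ³ → ℝ³} {M : ℝ≥0∞}
    (hM : ∀ k : ℕ, ∫⁻ y in ball (0 : ℝ³) (c ^ (k + 1)), (‖a y‖ₑ ^ 2 + ‖w y‖ₑ ^ 2) ≤
      ENNReal.ofReal (c ^ (k + 1)) * M)
    {x : ℝ³} (hx : x ∈ ball (0 : ℝ³) c) :
    ∫⁻ y in (ball (0 : ℝ³) (c ^ 2))ᶜ, ‖pressureForm (x - y) (a y) (w y)‖ₑ ≤ farConst c * M := by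
  have hc0 : 0 < c := one_pos.trans hc
  have hc1 : 0 < 1 - c⁻¹ := sub_pos.2 (inv_lt_one_of_one_lt₀ hc)
  rw [mem_ball_zero_iff] at hx
  -- `ab ≤ a² + b²` (the tree's `ennreal_mul_le_sq_add_sq` of `NSVorticityDifference`, not imported)
  have hamgm : ∀ a b : ℝ≥0∞, a * b ≤ a ^ 2 + b ^ 2 := fun a b => by
    rcases le_total a b with h | h
    · calc a * b ≤ b * b := mul_le_mul' h le_rfl
        _ = b ^ 2 := (sq b).symm
        _ ≤ a ^ 2 + b ^ 2 := le_add_self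
    · calc a * b ≤ a * a := mul_le_mul' le_rfl h
        _ = a ^ 2 := (sq a).symm
        _ ≤ a ^ 2 + b ^ 2 := le_self_add
  -- the annuli
  set A : ℕ → Set ℝ³ := fun j => {y | c ^ (j + 2) ≤ ‖y‖ ∧ ‖y‖ < c ^ (j + 3)} with hA
  have hcover : (ball (0 : ℝ³) (c ^ 2))ᶜ ⊆ ⋃ j, A j := by
    intro y hy
    rw [mem_compl_iff, mem_ball_zero_iff, not_lt] at hy
    have hy1 : 1 ≤ ‖y‖ := (one_le_pow₀ hc.le).trans hy
    obtain ⟨n, hn, hn'⟩ := exists_nat_pow_near hy1 hc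
    have hn2 : 2 ≤ n := by
      by_contra h
      have : ‖y‖ < c ^ 2 := hn'.trans_le (pow_le_pow_right₀ hc.le (by omega))
      exact absurd hy (not_le.2 this)
    obtain ⟨j, rfl⟩ := Nat.exists_eq_add_of_le' hn2
    exact mem_iUnion.2 ⟨j, hn, hn'⟩
  -- the per-annulus constants
  set d : ℝ := (Real.pi * (1 - c⁻¹) ^ 3 * c ^ 3)⁻¹ with hd
  set K : ℕ → ℝ≥0∞ := fun j => ENNReal.ofReal (Real.pi * ((1 - c⁻¹) * c ^ (j + 2)) ^ 3)⁻¹ with hK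
  have hKc : ∀ j, K j * ENNReal.ofReal (c ^ (j + 3)) =
      ENNReal.ofReal d * ENNReal.ofReal (c⁻¹ ^ 2) ^ j := by
    intro j
    rw [hK, ← ENNReal.ofReal_pow (by positivity), ← ENNReal.ofReal_mul (by positivity),
      ← ENNReal.ofReal_mul (by positivity)]
    congr 1
    have hu : 0 < c ^ j := pow_pos hc0 j
    have e1 : (c⁻¹ ^ 2) ^ j = ((c ^ j) ^ 2)⁻¹ := by
      rw [← pow_mul, inv_pow, ← pow_mul, mul_comm]
    have e2 : c ^ (j + 2) = c ^ j * c ^ 2 := pow_add _ _ _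
    have e3 : c ^ (j + 3) = c ^ j * c ^ 3 := pow_add _ _ _
    rw [e1, e2, e3, hd]
    field_simp
  -- the bound on one annulus
  have hann : ∀ j, ∫⁻ y in A j, ‖pressureForm (x - y) (a y) (w y)‖ₑ ≤
      K j * (ENNReal.ofReal (c ^ (j + 3)) * M) := by
    intro j
    have hpt : ∀ y ∈ A j, ‖pressureForm (x - y) (a y) (w y)‖ₑ ≤
        K j * (‖a y‖ₑ ^ 2 + ‖w y‖ₑ ^ 2) := by
      intro y hy
      have hdist : (1 - c⁻¹) * c ^ (j + 2) ≤ ‖x - y‖ :=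
        sub_norm_ge_of_mem_annulus hc hx (by omega) hy.1
      have hpos : 0 < (1 - c⁻¹) * c ^ (j + 2) := by positivity
      refine (enorm_pressureForm_le _ _ _).trans (mul_le_mul' ?_ (hamgm _ _))
      refine ENNReal.ofReal_le_ofReal (inv_anti₀ (by positivity) ?_)
      gcongr
    have hAm : MeasurableSet (A j) :=
      (measurableSet_le measurable_const measurable_norm).inter
        (measurableSet_lt measurable_norm measurable_const)
    calc ∫⁻ y in A j, ‖pressureForm (x - y) (a y) (w y)‖ₑ
        ≤ ∫⁻ y in A j, K j * (‖a y‖ₑ ^ 2 + ‖w y‖ₑ ^ 2) := setLIntegral_mono' hAm hpt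
      _ = K j * ∫⁻ y in A j, (‖a y‖ₑ ^ 2 + ‖w y‖ₑ ^ 2) :=
          lintegral_const_mul' _ _ ENNReal.ofReal_ne_top
      _ ≤ K j * ∫⁻ y in ball (0 : ℝ³) (c ^ (j + 2 + 1)), (‖a y‖ₑ ^ 2 + ‖w y‖ₑ ^ 2) := by
          refine mul_le_mul' le_rfl (lintegral_mono_set fun y hy => ?_)
          rw [mem_ball_zero_iff]
          exact hy.2
      _ ≤ K j * (ENNReal.ofReal (c ^ (j + 3)) * M) := mul_le_mul' le_rfl (hM (j + 2))
  -- summation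
  calc ∫⁻ y in (ball (0 : ℝ³) (c ^ 2))ᶜ, ‖pressureForm (x - y) (a y) (w y)‖ₑ
      ≤ ∫⁻ y in ⋃ j, A j, ‖pressureForm (x - y) (a y) (w y)‖ₑ := lintegral_mono_set hcover
    _ ≤ ∑' j, ∫⁻ y in A j, ‖pressureForm (x - y) (a y) (w y)‖ₑ := lintegral_iUnion_le _ _
    _ ≤ ∑' j, K j * (ENNReal.ofReal (c ^ (j + 3)) * M) := ENNReal.tsum_le_tsum hann
    _ = ∑' j, (ENNReal.ofReal d * ENNReal.ofReal (c⁻¹ ^ 2) ^ j) * M := by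
        refine tsum_congr fun j => ?_
        rw [← mul_assoc, hKc]
    _ = ENNReal.ofReal d * (∑' j, ENNReal.ofReal (c⁻¹ ^ 2) ^ j) * M := by
        rw [ENNReal.tsum_mul_right, ENNReal.tsum_mul_left]
    _ = farConst c * M := by
        rw [ENNReal.tsum_geometric, farConst, hd]

end FarField

/-! ## Splitting a bilinear principal value into near and far parts -/

/-- Homogeneity of the pressure form: `B_z(ta, tc) = t² B_z(a, c)`. [folklore] -/
theorem pressureForm_smul_smul (z a c : ℝ³) (t : ℝ) :
    pressureForm z (t • a) (t • c) = t ^ 2 * pressureForm z a c := by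
  simp only [pressureForm, real_inner_smul_left, real_inner_smul_right]
  ring

/-- **Near/far splitting of the bilinear principal value** (Bradshaw–Tsai 2019, p. 10: "To bound
the principal value integral in (3.8), we need to split the integral into local and non-local
parts … `=: π_near(x,t) + π_far(x,t)`"), with a cut-off `ζ` equal to `1` on `B_{R₁}` in place of
the sharp indicator: if `x ∈ B_r`, `r < R₁`, the pair `(b, w)` has the bilinear principal value
`L` at `x` and the cut pair `(ζb, ζw)` has the principal value `L'` at `x`, then the far integrand
`(1 − ζ²) Σ Kᵢⱼ(x−y) bᵢ(y) wⱼ(y)` is integrable and `L = L' + ∫ (1 − ζ(y)²) Σ Kᵢⱼ(x−y) bᵢ(y) wⱼ(y) dy`.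
[cite: BradshawTsai2019, §3 proof of Prop 3.1 (splitting π_near + π_far, p. 10)] -/
theorem HasPressureFormPV.eq_add_far {b w : ℝ³ → ℝ³} {ζ : ℝ³ → ℝ} {r R₁ : ℝ} (hrR : r < R₁)
    (hζ : ∀ y, ‖y‖ < R₁ → ζ y = 1) {x : ℝ³} (hx : ‖x‖ < r) {L L' : ℝ}
    (hL : HasPressureFormPV b w x L)
    (hL' : HasPressureFormPV (fun y => ζ y • b y) (fun y => ζ y • w y) x L') :
    Integrable (fun y => (1 - ζ y ^ 2) * pressureForm (x - y) (b y) (w y)) ∧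
      L = L' + ∫ y, (1 - ζ y ^ 2) * pressureForm (x - y) (b y) (w y) := by
  set F : ℝ³ → ℝ := fun y => pressureForm (x - y) (b y) (w y) with hF
  set Fn : ℝ³ → ℝ := fun y => pressureForm (x - y) (ζ y • b y) (ζ y • w y) with hFn
  set Ff : ℝ³ → ℝ := fun y => (1 - ζ y ^ 2) * pressureForm (x - y) (b y) (w y) with hFf
  have hFn_eq : ∀ y, Fn y = ζ y ^ 2 * F y := fun y => pressureForm_smul_smul _ _ _ _
  have hFf_eq : ∀ y, Ff y = F y - Fn y := fun y => by rw [hFn_eq]; simp only [hFf, hF]; ring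
  -- the far integrand vanishes on `B_{R₁}`, hence on small balls around `x`
  have hvan : ∀ y, ‖y‖ < R₁ → Ff y = 0 := fun y hy => by
    simp only [hFf, hζ y hy, one_pow, sub_self, zero_mul]
  have hballs : ∀ᶠ δ in 𝓝[>] (0 : ℝ), closedBall x δ ⊆ ball (0 : ℝ³) R₁ := by
    have hpos : 0 < R₁ - r := sub_pos.2 hrR
    filter_upwards [Ioo_mem_nhdsGT hpos] with δ hδ
    intro y hy
    rw [mem_closedBall, dist_eq_norm] at hy
    rw [mem_ball_zero_iff]
    calc ‖y‖ = ‖(y - x) + x‖ := by rw [sub_add_cancel]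
      _ ≤ ‖y - x‖ + ‖x‖ := norm_add_le _ _
      _ < R₁ := by linarith [hδ.2]
  -- integrability of the far integrand
  have hint : ∀ᶠ δ in 𝓝[>] (0 : ℝ), IntegrableOn Ff (closedBall x δ)ᶜ ∧
      closedBall x δ ⊆ ball (0 : ℝ³) R₁ := by
    filter_upwards [hL.1, hL'.1, hballs] with δ h1 h2 h3
    exact ⟨(h1.sub h2).congr_fun (fun y _ => (hFf_eq y).symm) (measurableSet_closedBall.compl), h3⟩
  obtain ⟨δ₀, hδ₀mem, hδ₀⟩ := (hint.and self_mem_nhdsWithin).exists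
  have hFfi : Integrable Ff := by
    have h0 : ∀ y, y ∉ (closedBall x δ₀)ᶜ → Ff y = 0 := fun y hy => by
      rw [mem_compl_iff, not_not] at hy
      exact hvan y (mem_ball_zero_iff.1 (hδ₀mem.2 hy))
    exact (integrableOn_iff_integrable_of_support_subset (fun y hy => by
      by_contra h; exact hy (h0 y h))).1 hδ₀mem.1
  refine ⟨hFfi, ?_⟩
  -- the truncated integrals split for small `δ`
  have hsplit : ∀ᶠ δ in 𝓝[>] (0 : ℝ), truncatedPressureFormIntegral b w x δ =
      truncatedPressureFormIntegral (fun y => ζ y • b y) (fun y => ζ y • w y) x δ + ∫ y, Ff y := by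
    filter_upwards [hL.1, hL'.1, hballs] with δ h1 h2 h3
    have hfar : ∫ y in (closedBall x δ)ᶜ, Ff y = ∫ y, Ff y :=
      setIntegral_eq_integral_of_forall_compl_eq_zero fun y hy => by
        rw [mem_compl_iff, not_not] at hy
        exact hvan y (mem_ball_zero_iff.1 (h3 hy))
    rw [truncatedPressureFormIntegral, truncatedPressureFormIntegral, ← hfar,
      ← integral_add h2 (hFfi.integrableOn)]
    refine integral_congr_ae (ae_of_all _ fun y => ?_)
    show F y = Fn y + Ff y
    rw [hFf_eq]; ring
  have hlim : Tendsto (truncatedPressureFormIntegral b w x) (𝓝[>] 0) (𝓝 (L' + ∫ y, Ff y)) :=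
    (hL'.2.add_const _).congr' (hsplit.mono fun δ hδ => hδ.symm)
  exact tendsto_nhds_unique hL.2 hlim

/-- **The far part is dominated by the tail integral**: if `|ζ| ≤ 1` and `ζ = 1` on `B_{R₁}` then
`|∫ (1 − ζ²) Σ Kᵢⱼ(x−y) bᵢ wⱼ| ≤ ∫_{|y| ≥ R₁} |Σ Kᵢⱼ(x−y) bᵢ(y) wⱼ(y)| dy`. [folklore] -/
theorem enorm_integral_far_le {b w : ℝ³ → ℝ³} {ζ : ℝ³ → ℝ} {R₁ : ℝ}
    (hζ : ∀ y, ‖y‖ < R₁ → ζ y = 1) (hζ1 : ∀ y, |ζ y| ≤ 1) (x : ℝ³) :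
    ‖∫ y, (1 - ζ y ^ 2) * pressureForm (x - y) (b y) (w y)‖ₑ ≤
      ∫⁻ y in (ball (0 : ℝ³) R₁)ᶜ, ‖pressureForm (x - y) (b y) (w y)‖ₑ := by
  refine (enorm_integral_le_lintegral_enorm _).trans ?_
  rw [← lintegral_indicator measurableSet_ball.compl]
  refine lintegral_mono fun y => ?_
  by_cases hy : ‖y‖ < R₁
  · have : y ∉ (ball (0 : ℝ³) R₁)ᶜ := fun h => h (mem_ball_zero_iff.2 hy)
    simp [hζ y hy, indicator_of_notMem this]
  · have hmem : y ∈ (ball (0 : ℝ³) R₁)ᶜ := fun h => hy (mem_ball_zero_iff.1 h)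
    rw [indicator_of_mem hmem, enorm_mul]
    refine mul_le_of_le_one_left' ?_
    rw [Real.enorm_eq_ofReal_abs, ← ENNReal.ofReal_one]
    refine ENNReal.ofReal_le_ofReal ?_
    have h1 : ζ y ^ 2 ≤ 1 := by
      have := hζ1 y
      rw [← sq_abs]; nlinarith [abs_nonneg (ζ y)]
    rw [abs_le]
    constructor <;> nlinarith [sq_nonneg (ζ y)]


end BradshawTsai2019

end Literature.Analysis.FluidPDE

end
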